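import Literature.MathematicalPhysics.QuantumFieldTheory.Balaban1983to89.B8LeafKnitZd3E
import Literature.MathematicalPhysics.QuantumFieldTheory.Balaban1983to89.B8SockHFPOfSockLetters

/-!
# `Balaban1983to89.B8LeafKnitZd3Letters` — [Balaban1985RegularSpaces] Lemma 1 – Thm 8: THE N05 KNIT WITH THE PROPOSITION-5 FIXED-POINT SOCKETS SERVED BY [4]'s
# LETTERS — `pub-ymgap-dag-n05-a` g7's ι-generic knit `B8LeafKnitZd3E.b8LeafRS_zd3_map_b9allE` ∕ `thm2_of135_zd3_map_b9allE` with `SockHFP₀`∕`SockHFP`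
# DISCHARGED by `B8SockHFPOfSockLetters.exists_threshold_sockHFP_pair` on the members where the letters route can serve them (towers ⊂ Ω_j at every truncation,
# index law №8)

statement-level skeleton of published theorems with citation tags; proofs where landed; nothing here is a claim about the
Yang–Mills mass gap

PDF held: `paper:balaban1985-cmp99-regular-spaces-gauge-fixing` (journal page = PDF page + 74); pp. 79–101 (Lemma 1 – Thm 8), p. 88 (Thm 4), p. 89 («we take
Λ_{k−1} ∪ B(Λ_k) as Λ_{k−1}»), p. 77 («Bʲ(y) ⊂ Ω_j», «we admit … Ω_j = T_η»), pp. 91–94 (Sect. D, Prop. 5).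

WHY THIS FILE (cell `pub-ymgap`, R134 acceleration seat `pub-ymgap-dag-n05-d`, strategy s2 = BY-NAME KNIT of DAG node N05 = [B8]; this seat's LOCATED-1 ∕ ref-A's junction
flag J2; dag-lead REBALANCE №53; count-neutral).  The knit of record over the `Ω₀ = ℤᵈ` family carried the Proposition-5 sockets `SockHFP₀`∕`SockHFP` as ONE ∀-binder over ALL of
`ZdIdx d L` — UNSATISFIABLE at members with free lower truncations (J2).  n05-a g7's `B8LeafKnitZd3E` re-states the knit over an ARBITRARY INDEX MAP `ι : J → ZdIdx d L`
with sockets required only at `ι j`, in the repaired uniqueness currency `SockP5uE` (n04-b's DECL); this seat's `B8SockHFPOfSockLetters.exists_threshold_sockHFP_pair`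
(p456870) serves `SockHFP₀`∕`SockHFP` at every member carrying the `ZdIdx` laws + (L1) towers ⊂ Ω_j AT EVERY TRUNCATION + (L2) INDEX LAW №8, from the [4]-letters socket
`SockLetters`, the b9 socket `SB9all` and the free-constant condition `3·(2dL²)·B_G·B_R ≤ inp.B₀′`.  THIS FILE composes the two: the knit over `ι` with the Prop-5 fixed-point
sockets REPLACED by the letters socket, (L1), (L2) displayed per member — at `ι := fun j : Node00.IdxB8Sub θ => j.1.1` these are node00-def's `IdxB8Laws.tower_all ∕
trunc_lt ∕ trunc_top` (the Summits face `BalabanUVNodesN05AtRecord11Sub` v1.1 instantiates it so).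

WHAT THIS FILE PROVES (kernel, 0 sorry, theorems only):
* **`b8LeafRS_zd3_map_lettersE`** — the surviving leaf `B8LeafRS … (fun j => zdGF3 𝔸 L β len (ι j)) lan cub toAxial` from: `SockLetters L B_G B_R B₀′_H B₂′ c_L` at every
  `ι j`, `SockP5uE L inp.B₀ cu′ cu` at every `ι j`, `SB9all` at every `ι j`, (L1)∕(L2) at every `ι j`, `hΩ : (ι j).Ω 0 = univ`, `hfree`, `p5e p5u p6 p7 t8S`;
* **`thm2_of135_zd3_map_lettersE`** — THEOREM 2 AS PRINTED ((1.35) on Λ_j, chair R453 (C)) over `ι`, same replacement (n05-a's `thm2_of135_zd3_map_b9allE` BY NAME).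

HONEST SCOPE.  Composition by name; [4] Thms 3.1–3.3 (the letters), Prop. 5's uniqueness (1.109) (`SockP5uE`), [4] Thm 3.3 in Prop. 3's frame (`SB9all`) and the five
printed members remain hypotheses; N05 NOT discharged; one finite T⁴ programme at fixed ε; nothing continuum ∕ ℝ⁴ ∕ OS ∕ mass-gap ∕ Clay.  Unit `pub-ymgap-dag-n05-d` (g0),
2026-08-26.
-/

noncomputable section

open NormedSpace

namespace Literature.MathematicalPhysics.QuantumFieldTheory.Balaban1983to89.B8LeafKnitZd3Letters

open B7Prop1Explicit B7Prop2Explicit B7Prop1Local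
open B8Ineq132 (InAk BondTouches Under)
open B8Lemma1NonAbelian (mulCfg blockPairNA)
open B8Ineq130 (tlo thi)
open B8LeafKnitRS (B8LeafRS)
open B8LeafModelZd (ZdIdx)
open B8LeafModelZdSockP5uE (SockP5uE)
open B8LeafModelZd3 (zdGF3 SockB9P3)
open B8LeafModelZdSockLetters (SockLetters)
open B8SockHFPOfSockLetters (exists_threshold_sockHFP_pair)
open B8LeafKnitZd3E (b8LeafRS_zd3_map_b9allE thm2_of135_zd3_map_b9allE)
open QuantumLattice (blockSites)

-- `Site` alone could resolve to the torus sites of `Setup.lean`; re-export the `ℤ^d` sites of `B7Prop1Explicit`.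
export B7Prop1Explicit (Site)

variable {d : ℕ}

section Knit

variable {𝔸 : Type} [CStarAlgebra 𝔸] [Nontrivial 𝔸]
variable {I₃ I₄ : Type} {lan : I₃ → B8.LandauData} {cub : I₄ → B8.CubeData}

/-- **THE N05 KNIT OVER AN INDEX MAP `ι`, PROPOSITION-5 FIXED-POINT SOCKETS SERVED BY [4]'s LETTERS.**  For `d, L ≥ 2`, the leaf's inputs `inp` with `2 ≤ 5dL·inp.B₀`,
`B₀(β₀) > 0`, `C₂ ≥ 2097152(d+1)²`, [4]-letters constants `B₀′_H > 0`, `B₂′, B_G, B_R ≥ 0` with threshold `c_L > 0`, b9 threshold `c_b9 > 0`, Prop. 5's uniqueness radius `cu`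
with threshold `cu′ > 0`, THE FREE-CONSTANT CONDITION `3·(2dL²)·B_G·B_R ≤ inp.B₀′` (p. 93 «with RD*A subtracted»), an index map `ι : J → ZdIdx d L` into `Ω₀ = ℤᵈ` members
(`hΩ`) carrying (L1) towers ⊂ Ω_j AT EVERY TRUNCATION and (L2) INDEX LAW №8 (p. 89), the letters socket `SockLetters`, the uniqueness socket `SockP5uE` and the b9 socket
`SB9all` at every `ι j`, and the five printed members `p5e p5u p6 p7 t8S` — the surviving leaf over `fun j => zdGF3 𝔸 L β len (ι j)`.  Proof: n05-a g7's
`b8LeafRS_zd3_map_b9allE` with `SockHFP₀`∕`SockHFP` := `exists_threshold_sockHFP_pair` (ONE threshold `c_F` for the whole family).  NOT a discharge of N05.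
[cite: Balaban1985RegularSpaces, Lemma 1 p.79, Thm 2 p.83, Prop. 3 p.87, Thm 4 p.88, Prop. 5 (1.106)–(1.109) p.94, (1.102)–(1.103) p.93 (kernel instances + the letters route); Prop. 6 p.99, Prop. 7 p.100, Thm 8 p.101 (named hypotheses); Balaban1985BackgroundPropagators, Thms 3.1–3.3 pp.397–398 (the letters, hypotheses)] -/
theorem b8LeafRS_zd3_map_lettersE (hd2 : 2 ≤ d) {L : ℕ} (hL : 2 ≤ L) (Lb : ℕ) (β : ℝ) (len : Site d → ℝ) (inp : B8.B9Inputs)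
    {B₀β C₂ cu cu' cB9 B₁ B₂ c₁ B₀'H B₂' BG BR cL : ℝ} (hB : 2 ≤ 5 * (d : ℝ) * L * inp.B₀) (hB₀β : 0 < B₀β)
    (hC₂ : 2097152 * ((d : ℝ) + 1) ^ 2 ≤ C₂) (hcu : 0 < cu) (hcu' : 0 < cu') (hcB9 : 0 < cB9)
    (hB₀'H : 0 < B₀'H) (hB₂' : 0 ≤ B₂') (hBG : 0 ≤ BG) (hBR : 0 ≤ BR) (hcL : 0 < cL)
    (hfree : 3 * (2 * (d : ℝ) * (L : ℝ) ^ 2) * BG * BR ≤ inp.B₀')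
    {J : Type} (ι : J → ZdIdx d L) (hΩ : ∀ j, (ι j).Ω 0 = Set.univ)
    -- the two member laws the letters route reads, at every member of the map
    (hL1 : ∀ j : J, ∀ m, m ≤ (ι j).k → ∀ n, n ≤ m → ∀ y ∈ (ι j).Λs m n, ∀ x, InBox (tlo L y n) (thi L y n) x → x ∈ (ι j).Ω n)
    (hL2lt : ∀ j : J, ∀ m, m < (ι j).k → ∀ n, n < m → (ι j).Λs m n = (ι j).Λs (m + 1) n)
    (hL2top : ∀ j : J, ∀ m, m < (ι j).k → ∀ x, x ∈ (ι j).Λs m m ↔ x ∈ (ι j).Λs (m + 1) m ∨ ∃ y ∈ (ι j).Λs (m + 1) (m + 1), x ∈ blockSites L y)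
    -- the sockets at every member of the map
    (SLet : ∀ j : J, SockLetters (𝔸 := 𝔸) L BG BR B₀'H B₂' cL (ι j).η (ι j).k (ι j).Ω (ι j).Λs)
    (SP5u : ∀ j : J, SockP5uE (𝔸 := 𝔸) L inp.B₀ cu' cu (ι j).η (ι j).k (ι j).Ω (ι j).Λs)
    (SB9all : ∀ j : J, ∀ m, m ≤ (ι j).k → SockB9P3 (𝔸 := 𝔸) L inp.B₀ B₀β cB9 β len (ι j).η m (ι j).Ω (ι j).Λs (ι j).Λb)
    {toAxial : ∀ j : J, (zdGF3 𝔸 L β len (ι j)).Cfg → (zdGF3 𝔸 L β len (ι j)).Pert → (zdGF3 𝔸 L β len (ι j)).Pert}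
    (p5e : B8.Prop5Exists inp.B₀' B₁ lan) (p5u : B8.Prop5Unique lan) (p6 : B8.Prop6Printed d (L : ℝ) B₁ c₁ cub)
    (p7 : B8SectGH.Prop7PrintedR (fun j : J => zdGF3 𝔸 L β len (ι j)) toAxial)
    (t8 : B8Thm8Surviving.Thm8SurvivingAt 1 B₁ B₂ (fun j : J => zdGF3 𝔸 L β len (ι j))) :
    B8LeafRS d (L : ℝ) C₂ (5 * (d : ℝ) * L * inp.B₀) inp.B₀' B₁ B₂ c₁ inp B₀β (blockPairNA d Lb 𝔸)
      (fun j : J => zdGF3 𝔸 L β len (ι j)) lan cub toAxial := by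
  obtain ⟨cF, hcF, hpair⟩ := exists_threshold_sockHFP_pair (𝔸 := 𝔸) hd2 hL inp.B₀_pos inp.B₀'_pos hB hB₀'H hB₂' hBG hBR hcB9 hcL hfree
  exact b8LeafRS_zd3_map_b9allE hd2 hL Lb β len inp hB hB₀β hC₂ hcu hcF hcF hcu' hcB9 ι hΩ
    (fun j => (hpair (ι j).hη (ι j).hk (ι j).hΩ (ι j).hbox (ι j).hclass (hL1 j) (hL2lt j) (hL2top j) (SLet j) (SB9all j)).1)
    (fun j => (hpair (ι j).hη (ι j).hk (ι j).hΩ (ι j).hbox (ι j).hclass (hL1 j) (hL2lt j) (hL2top j) (SLet j) (SB9all j)).2)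
    SP5u SB9all p5e p5u p6 p7 t8

end Knit

section Thm2

variable {𝔸 : Type} [CStarAlgebra 𝔸] [Nontrivial 𝔸]

/-- **THEOREM 2 AS PRINTED ((1.35) on Λ_j; chair R453 (C)) OVER AN INDEX MAP `ι`, PROPOSITION-5 FIXED-POINT SOCKETS SERVED BY [4]'s LETTERS** — n05-a g7's
`thm2_of135_zd3_map_b9allE` with `SockHFP₀`∕`SockHFP` := `exists_threshold_sockHFP_pair`; hypotheses as in `b8LeafRS_zd3_map_lettersE` minus the leaf's residual data;
index law №11 (`cover`) is the displayed first hypothesis of the conclusion, as in n05-a's statement.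
[cite: Balaban1985RegularSpaces, Thm 2 p.83, (1.35) p.82, (1.65) p.87, Thm 4 p.88, Prop. 5 (1.106)–(1.109) p.94, (1.59) p.86; Balaban1985BackgroundPropagators, Thms 3.1–3.3 pp.397–398] -/
theorem thm2_of135_zd3_map_lettersE (hd2 : 2 ≤ d) {L : ℕ} (hL : 2 ≤ L) {β : ℝ} {len : Site d → ℝ}
    {B₀ B₀' B₀β cu cu' cB9 B₀'H B₂' BG BR cL : ℝ} (hB₀ : 0 < B₀) (hB₀' : 0 < B₀') (hB₀β : 0 < B₀β) (hB : 2 ≤ 5 * (d : ℝ) * L * B₀)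
    (hcu : 0 < cu) (hcu' : 0 < cu') (hcB9 : 0 < cB9) (hB₀'H : 0 < B₀'H) (hB₂' : 0 ≤ B₂') (hBG : 0 ≤ BG) (hBR : 0 ≤ BR) (hcL : 0 < cL)
    (hfree : 3 * (2 * (d : ℝ) * (L : ℝ) ^ 2) * BG * BR ≤ B₀')
    {J : Type} (ι : J → ZdIdx d L) (hΩ : ∀ j, (ι j).Ω 0 = Set.univ)
    (hL1 : ∀ j : J, ∀ m, m ≤ (ι j).k → ∀ n, n ≤ m → ∀ y ∈ (ι j).Λs m n, ∀ x, InBox (tlo L y n) (thi L y n) x → x ∈ (ι j).Ω n)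
    (hL2lt : ∀ j : J, ∀ m, m < (ι j).k → ∀ n, n < m → (ι j).Λs m n = (ι j).Λs (m + 1) n)
    (hL2top : ∀ j : J, ∀ m, m < (ι j).k → ∀ x, x ∈ (ι j).Λs m m ↔ x ∈ (ι j).Λs (m + 1) m ∨ ∃ y ∈ (ι j).Λs (m + 1) (m + 1), x ∈ blockSites L y)
    (SLet : ∀ j : J, SockLetters (𝔸 := 𝔸) L BG BR B₀'H B₂' cL (ι j).η (ι j).k (ι j).Ω (ι j).Λs)
    (SP5u : ∀ j : J, SockP5uE (𝔸 := 𝔸) L B₀ cu' cu (ι j).η (ι j).k (ι j).Ω (ι j).Λs)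
    (SB9all : ∀ j : J, ∀ m, m ≤ (ι j).k → SockB9P3 (𝔸 := 𝔸) L B₀ B₀β cB9 β len (ι j).η m (ι j).Ω (ι j).Λs (ι j).Λb) :
    ∃ B₁ B₂ c₁ : ℝ, 0 < B₁ ∧ 0 < B₂ ∧ 0 < c₁ ∧
      ∀ i : J,
        (∀ ℓ, ℓ ≤ (ι i).k → ∀ w : Site d, (∀ x, InBox (tlo L w ℓ) (thi L w ℓ) x → x ∈ (ι i).Ω ℓ) →
          ∃ j, ℓ ≤ j ∧ j ≤ (ι i).k ∧ ∃ y ∈ (ι i).Λs (ι i).k j, Under L (j - ℓ) y w) →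
        ∀ α₀ α₁ : ℝ, 0 < α₀ → 0 < α₁ → α₀ + α₁ ≤ c₁ →
          ∀ (U₀ : (zdGF3 𝔸 L β len (ι i)).Cfg) (P : (zdGF3 𝔸 L β len (ι i)).Pert),
            (zdGF3 𝔸 L β len (ι i)).InA α₀ U₀ → (zdGF3 𝔸 L β len (ι i)).Reg335 α₀ U₀ → (zdGF3 𝔸 L β len (ι i)).InAAx α₀ U₀ P →
            (∀ j, j ≤ (ι i).k → ∀ (z : Site d) (μ : Fin d), BondTouches ((ι i).Λs (ι i).k j) z μ →
              (∀ x, InBox (loK L j z) (bondHiK L j z μ) x → x ∈ (ι i).Ω j) →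
              ‖(avgIter L (mulCfg P.2.1 U₀.1) j z μ : 𝔸) - (avgIter L U₀.1 j z μ : 𝔸)‖ ≤ α₁) →
            ∃ u : (zdGF3 𝔸 L β len (ι i)).GT, (zdGF3 𝔸 L β len (ι i)).Restricted U₀ u ∧
              ((zdGF3 𝔸 L β len (ι i)).C136 B₁ B₂ (α₀ + (11 * (d : ℝ) ^ 2 * α₀ + α₁)) U₀ ((zdGF3 𝔸 L β len (ι i)).act P u) ∧
                (zdGF3 𝔸 L β len (ι i)).C137 α₁ U₀ ((zdGF3 𝔸 L β len (ι i)).act P u) ∧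
                (zdGF3 𝔸 L β len (ι i)).Landau U₀ ((zdGF3 𝔸 L β len (ι i)).act P u) ∧
                (zdGF3 𝔸 L β len (ι i)).C139 B₁ (α₀ + (11 * (d : ℝ) ^ 2 * α₀ + α₁)) U₀ ((zdGF3 𝔸 L β len (ι i)).act P u)) ∧
              ∀ u' : (zdGF3 𝔸 L β len (ι i)).GT, (zdGF3 𝔸 L β len (ι i)).Restricted U₀ u' →
                (zdGF3 𝔸 L β len (ι i)).C136 B₁ B₂ (α₀ + (11 * (d : ℝ) ^ 2 * α₀ + α₁)) U₀ ((zdGF3 𝔸 L β len (ι i)).act P u') →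
                (zdGF3 𝔸 L β len (ι i)).C137 α₁ U₀ ((zdGF3 𝔸 L β len (ι i)).act P u') →
                (zdGF3 𝔸 L β len (ι i)).Landau U₀ ((zdGF3 𝔸 L β len (ι i)).act P u') →
                (zdGF3 𝔸 L β len (ι i)).C139 B₁ (α₀ + (11 * (d : ℝ) ^ 2 * α₀ + α₁)) U₀ ((zdGF3 𝔸 L β len (ι i)).act P u') →
                  u' = u := by
  obtain ⟨cF, hcF, hpair⟩ := exists_threshold_sockHFP_pair (𝔸 := 𝔸) (B₀ := B₀) (B₀' := B₀') hd2 hL hB₀ hB₀' hB hB₀'H hB₂' hBG hBR hcB9 hcL hfree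
  exact thm2_of135_zd3_map_b9allE hd2 hL hB₀ hB₀' hB₀β hB hcu hcF hcF hcu' hcB9 ι hΩ
    (fun j => (hpair (ι j).hη (ι j).hk (ι j).hΩ (ι j).hbox (ι j).hclass (hL1 j) (hL2lt j) (hL2top j) (SLet j) (SB9all j)).1)
    (fun j => (hpair (ι j).hη (ι j).hk (ι j).hΩ (ι j).hbox (ι j).hclass (hL1 j) (hL2lt j) (hL2top j) (SLet j) (SB9all j)).2)
    SP5u SB9all

end Thm2

#print axioms b8LeafRS_zd3_map_lettersE
#print axioms thm2_of135_zd3_map_lettersE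

end Literature.MathematicalPhysics.QuantumFieldTheory.Balaban1983to89.B8LeafKnitZd3Letters

end
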